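import Literature.MathematicalPhysics.QuantumFieldTheory.Balaban1983to89.B3TriangleAlphaGain
import Literature.MathematicalPhysics.QuantumFieldTheory.Balaban1983to89.B3

/-!
# `Balaban1983to89.B3Resummation336` — T. Bałaban, *(Higgs)₂,₃ quantum fields in a finite volume. III. Renormalization*, Commun. Math.
Phys. **88** (1983) 411–445 [Balaban1983Higgs3], pp. 443–444 [PDF 33–34]: the local term of (3.34) → the expression **(3.36)** —
*"moving all localization functions to the corresponding vertex … gives us a convergent expression plus the expression (3.36)"* and
*"we sum the expressions (3.36) over admissible orderings and indices and we get the expressions of the same type but with propagators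
G_{j₀}(0), G_{j₀}"* — PROVED on the torus calculus (identity + quantitative degree-α bound + multilinear resummation)

statement-level skeleton of published theorems with citation tags; proofs where landed; nothing here is a claim about the Yang–Mills mass gap

PDF held: `paper:balaban1983-higgs-2-3-quantum-fields-finite-volume` (journal page = PDF page + 410); pp. 443–444 [PDF 33–34] read in the
OCR text and on the renders `run/shared/lean/pub/pub-balaban/b2b-balaban-ref1/pages/1983-cmp88-higgs23-III/1983-cmp88-higgs23-III-p033/p034-x2.png`.

CITATION HEADER (lean-in-tree rule).  Part of the lit-balaban TYPED SKELETON (HOME `run/shared/lean/pub/lit-balaban/`), PHASE 2, seat p20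
generation 5; companion of r15's `B3Sect3TriangleGraphs` ((3.33) `expr333`, (3.34) `eq334`/`local334`, (3.36) `local336`, the three-point
pairing `tripleSum`), of p20 g3's `B3TriangleAlphaGain` (`abs_tripleSum_le`, the degree-α bounds of the two transported terms of (3.34)) and
of p20 g4's `B3Resummation315` (the other three "sum over orderings and j-indices" sentences, pp. 437/439/440).  WHAT IS REPRODUCED: row
**B3.Eq3.33-3.38** of `HOME/lit-balaban-r15/ROWS-B3.md` (fold owner r15), the first paragraph of p. 444.

THE PRINTED TEXT (verbatim, p. 443–444).  After (3.34)/(3.35): *"This way all the expressions on the right side of (3.34) are convergent,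
except the first two. We transform further this expression moving all localization functions to the corresponding vertex. This gives us
a convergent expression plus the expression Σ_{x′} η^d Σ_{μ=1}^d g(x′)A_μ(x′)φ′(x′) (a product of the values of all the localization
functions at the point x′) (Σ_{x,x″} η^{2d}Γ′_μ(x,x′,x″)) φ″(x′), (3.36) where Γ′_μ is given by the same formula as before, but with the
summations unrestricted. Next we sum the expressions (3.36) over admissible orderings and indices and we get the expressions of the same
type but with propagators G_{j₀}(0), G_{j₀}, where j₀ is the lowest index of the external legs."*

WHAT IS TYPED / PROVED, and how.  §1 MOVING THE LOCALIZATION FUNCTIONS.  The kernel of the local term of (3.34) with the localization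
functions `g₁` of the vertex `x` and `g₃` of the vertex `x″` still at their vertices is `locKernel g₁ g₃ Γ′ = g₁(x)g₃(x″)Γ′_μ(x,x′,x″)`
(`Γ′` = the unrestricted kernel); `local334_locKernel`: `local334(locKernel g₁ g₃ Γ′) = local336(Γ′; locs = g·g₁·g₃ at x′) + local334(moveRem
g₁ g₃ Γ′)` with the remainder kernel `moveRem = (g₁(x)g₃(x″) − g₁(x′)g₃(x′))Γ′` (exact algebra); **`abs_local334_moveRem_le`** = the printed
*"convergent expression"*, quantitatively: under a (2.10)-type tree bound of `Γ′` through `x′`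
(`‖Γ′_μ(x,x′,x″)v‖ ≤ Ke^{−δ|x−x′|/s}e^{−δ|x′−x″|/s}‖v‖`, `s = L^jη`), Hölder-α and sup bounds on `g₁`, `g₃` (`H₁,B₁`, `H₃,B₃`) and `|gA_μ| ≤ B`,
`|local334(moveRem)| ≤ d·K·B·(H₁B₃ + B₁H₃)(1+2/δ)·s^α·Σ_{x,x′,x″}η^{3d}‖φ′(x′)‖‖φ″(x′)‖e^{−½δ|x−x′|/s}e^{−½δ|x′−x″|/s}` — the gain `(L^jη)^α` of a
generalized graph of degree `+α` (mechanism: p20 g3's `abs_tripleSum_le` + `B3SubtractionAlphaGain.exp_mul_rpow_le`).  §2 `local334`/`local336`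
are LINEAR in the kernel (`local334_add`, `local334_finset_sum`, `local336_finset_sum`).  §3 THE RESUMMATION OF (3.36): **`local336_resum`** —
for EVERY multilinear dependence `Φ` of the unrestricted kernel `Γ′` on the kernels of the `m` internal lines and every family of
decompositions (2.6) `G_l = Σ_{j<j₀}G_l^{(j)}` (r15's `B3.Display26`, PROVED for the concrete towers by p14 `B3Eq26Tower` / p03
`B3Ineq210ZeroTorus.sum_pieceT`), `Σ_{(j_1,…,j_m)∈[0,j₀)^m} local336(Φ(G_1^{(j_1)},…,G_m^{(j_m)})) = local336(Φ(G_1,…,G_m))` — *"expressions of the same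
type but with propagators G_{j₀}(0), G_{j₀}"*; the concrete three-line shape of the triangle graphs (2.20) `triKernel T K₁ K₂ K₃ =
K₁(x,x′)K₂(x′,x″)K₃(x,x″)·T_μ` is multilinear (`triKernel_sum`) and resums accordingly (`local336_triKernel_resum`).  As in `B3Resummation315`,
the admissibility bookkeeping of the orderings (row B3.Eq2.7) is not re-derived: the sum taken is over all `0 ≤ j_l < j₀`.  The kernel bound
and the Hölder bounds are HYPOTHESES (rows B3.Eq2.10–2.12, p. 420 localizations).  D-0026: no named fact; `locKernel`/`moveRem`/`triKernel` are
defs with bodies; standard axioms.  Unit `lit-balaban-p20` (literature-prover-lit-balaban-p20-g5-0), 2026-08-21.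
-/

open scoped BigOperators RealInnerProductSpace

namespace Literature.MathematicalPhysics.QuantumFieldTheory.Balaban1983to89.B3Resummation336

open LatticeFieldCalculus B3Sect3ScalarSelfEnergy B3Sect3VectorSelfEnergy B3Sect3TriangleGraphs B3SubtractionAlphaGain
  B3TriangleAlphaGain

noncomputable section

variable {P : Params} {j : ℕ} {W : Type*} [NormedAddCommGroup W] [InnerProductSpace ℝ W]

/-! ## 0. Elementary -/

/-- kernel: the `ℓ¹` torus distance is symmetric. [folklore] -/
private theorem tdist_comm' (x y : Site P j) : Site.tdist x y = Site.tdist y x := by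
  unfold Site.tdist
  exact Finset.sum_congr rfl fun μ _ => min_comm _ _

/-- kernel: keeping half of an exponential factor costs nothing, `e^{−δu/s} ≤ e^{−½δu/s}` (`u ≥ 0`, `δ, s > 0`). [folklore] -/
private theorem exp_le_exp_half' {δ s u : ℝ} (hδ : 0 < δ) (hs : 0 < s) (hu : 0 ≤ u) :
    Real.exp (-(δ * s⁻¹ * u)) ≤ Real.exp (-(δ / 2 * s⁻¹ * u)) := by
  rw [Real.exp_le_exp]
  have : 0 ≤ δ / 2 * s⁻¹ * u := by positivity
  nlinarith

/-! ## 1. Moving the localization functions to the vertex `x′` -/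

section Move

/-- The kernel of the local (last) term of (3.34) BEFORE the localization functions are moved: the localization function `g₁` of the
vertex `x` and `g₃` of the vertex `x″` multiply the unrestricted kernel `Γ′_μ(x,x′,x″)` of (3.36) at their own vertices.
[cite: Balaban1983Higgs3, (3.36) p.444] -/
def locKernel (g₁ g₃ : SiteField P j ℝ) (Γ' : Kernel3 P j W) : Kernel3 P j W :=
  fun μ x x' x'' => (g₁ x * g₃ x'') • Γ' μ x x' x''

/-- The remainder kernel of the move *"moving all localization functions to the corresponding vertex"*: the difference
`(g₁(x)g₃(x″) − g₁(x′)g₃(x′))Γ′_μ(x,x′,x″)` — the *"convergent expression"* of p. 444. [cite: Balaban1983Higgs3, (3.36) p.444] -/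
def moveRem (g₁ g₃ : SiteField P j ℝ) (Γ' : Kernel3 P j W) : Kernel3 P j W :=
  fun μ x x' x'' => (g₁ x * g₃ x'' - g₁ x' * g₃ x') • Γ' μ x x' x''

/-- **p. 444 [PDF 34]**, *"We transform further this expression moving all localization functions to the corresponding vertex. This gives
us a convergent expression plus the expression (3.36) … (a product of the values of all the localization functions at the point x′)"* — the
exact identity, PROVED: the local term of (3.34) with the kernel `g₁(x)g₃(x″)Γ′` equals (3.36) with `locs(x′) = g(x′)g₁(x′)g₃(x′)` plus the
local term with the remainder kernel `moveRem`. [cite: Balaban1983Higgs3, (3.36) p.444] -/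
theorem local334_locKernel (η : ℝ) (g₁ g₃ : SiteField P j ℝ) (Γ' : Kernel3 P j W) (g : SiteField P j ℝ) (A : VecField P j ℝ)
    (φ' φ'' : SiteField P j W) :
    local334 η (locKernel g₁ g₃ Γ') g A φ' φ'' =
      local336 η Γ' (fun x' => g x' * (g₁ x' * g₃ x')) A φ' φ'' + local334 η (moveRem g₁ g₃ Γ') g A φ' φ'' := by
  rw [local336, ← tripleSum_local, ← tripleSum_local, ← tripleSum_local]
  unfold tripleSum
  rw [← Finset.sum_add_distrib]
  refine Finset.sum_congr rfl fun x _ => ?_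
  rw [← Finset.sum_add_distrib]
  refine Finset.sum_congr rfl fun x' _ => ?_
  rw [← Finset.sum_add_distrib]
  refine Finset.sum_congr rfl fun x'' _ => ?_
  rw [← mul_add, ← Finset.sum_add_distrib]
  congr 1
  refine Finset.sum_congr rfl fun μ _ => ?_
  simp only [locKernel, moveRem, LinearMap.smul_apply, inner_smul_right]
  ring

/-- **p. 444 [PDF 34]**, the *"convergent expression"* of the move — quantitative bound, PROVED: with the tree bound
`‖Γ′_μ(x,x′,x″)v‖ ≤ Ke^{−δ|x−x′|/s}e^{−δ|x′−x″|/s}‖v‖` through the vertex `x′` (scale `s = L^jη`), the Hölder bounds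
`|g₁(z) − g₁(z′)| ≤ H₁|z−z′|^α`, `|g₃(z) − g₃(z′)| ≤ H₃|z−z′|^α`, the sup bounds `|g₁| ≤ B₁`, `|g₃| ≤ B₃`, `|g(x′)A_μ(x′)| ≤ B`, the local term
with the remainder kernel gains `s^α`: `|local334(moveRem g₁ g₃ Γ′)| ≤ d·K·B·(H₁B₃ + B₁H₃)·(1 + 2/δ)·s^α·
Σ_{x,x′,x″}η^{3d}‖φ′(x′)‖‖φ″(x′)‖e^{−½δ|x−x′|/s}e^{−½δ|x′−x″|/s}` (a generalized expression of degree `+α`). [cite: Balaban1983Higgs3, (3.36) p.444] -/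
theorem abs_local334_moveRem_le (η : ℝ) (hη : 0 < η) {α K B H₁ B₁ H₃ B₃ δ s : ℝ} (hα0 : 0 ≤ α) (hα1 : α ≤ 1) (hK : 0 ≤ K)
    (hB : 0 ≤ B) (hH₁ : 0 ≤ H₁) (hB₁ : 0 ≤ B₁) (hH₃ : 0 ≤ H₃) (hB₃ : 0 ≤ B₃) (hδ : 0 < δ) (hs : 0 < s)
    (Γ' : Kernel3 P j W) (g g₁ g₃ : SiteField P j ℝ) (A : VecField P j ℝ) (φ' φ'' : SiteField P j W)
    (hΓ : ∀ (μ : Fin P.d) (x x' x'' : Site P j) (v : W), ‖Γ' μ x x' x'' v‖ ≤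
      K * Real.exp (-(δ * s⁻¹ * (η * Site.tdist x x'))) * Real.exp (-(δ * s⁻¹ * (η * Site.tdist x' x''))) * ‖v‖)
    (hgA : ∀ (μ : Fin P.d) (x' : Site P j), |g x' * A ⟨x', μ⟩| ≤ B)
    (hg₁ : ∀ z z' : Site P j, |g₁ z - g₁ z'| ≤ H₁ * (η * Site.tdist z z') ^ α) (hg₁b : ∀ z, |g₁ z| ≤ B₁)
    (hg₃ : ∀ z z' : Site P j, |g₃ z - g₃ z'| ≤ H₃ * (η * Site.tdist z z') ^ α) (hg₃b : ∀ z, |g₃ z| ≤ B₃) :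
    |local334 η (moveRem g₁ g₃ Γ') g A φ' φ''| ≤
      P.d * (K * B * (H₁ * B₃ + B₁ * H₃) * (1 + 2 / δ) * s ^ α) *
        ∑ x : Site P j, ∑ x' : Site P j, ∑ x'' : Site P j, η ^ (3 * P.d) * (‖φ' x'‖ * (‖φ'' x'‖ *
          (Real.exp (-(δ / 2 * s⁻¹ * (η * Site.tdist x x'))) * Real.exp (-(δ / 2 * s⁻¹ * (η * Site.tdist x' x'')))))) := by
  rw [← tripleSum_local]
  refine abs_tripleSum_le η hη.le _ _ φ' _ (K * B * (H₁ * B₃ + B₁ * H₃) * (1 + 2 / δ) * s ^ α) _ fun μ x x' x'' => ?_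
  set u₁ : ℝ := η * Site.tdist x x' with hu₁
  set u₂ : ℝ := η * Site.tdist x' x'' with hu₂
  have hu₁0 : 0 ≤ u₁ := mul_nonneg hη.le (Nat.cast_nonneg _)
  have hu₂0 : 0 ≤ u₂ := mul_nonneg hη.le (Nat.cast_nonneg _)
  -- the difference of the products of localization functions
  have hdiff : |g₁ x * g₃ x'' - g₁ x' * g₃ x'| ≤ H₁ * u₁ ^ α * B₃ + B₁ * (H₃ * u₂ ^ α) := by
    have hsplit : g₁ x * g₃ x'' - g₁ x' * g₃ x' = (g₁ x - g₁ x') * g₃ x'' + g₁ x' * (g₃ x'' - g₃ x') := by ring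
    rw [hsplit]
    have h3 : |g₃ x'' - g₃ x'| ≤ H₃ * u₂ ^ α := by rw [hu₂, tdist_comm']; exact hg₃ x'' x'
    calc |(g₁ x - g₁ x') * g₃ x'' + g₁ x' * (g₃ x'' - g₃ x')|
        ≤ |(g₁ x - g₁ x') * g₃ x''| + |g₁ x' * (g₃ x'' - g₃ x')| := abs_add_le _ _
      _ = |g₁ x - g₁ x'| * |g₃ x''| + |g₁ x'| * |g₃ x'' - g₃ x'| := by rw [abs_mul, abs_mul]
      _ ≤ H₁ * u₁ ^ α * B₃ + B₁ * (H₃ * u₂ ^ α) :=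
          add_le_add (mul_le_mul (hg₁ x x') (hg₃b x'') (abs_nonneg _) (by positivity))
            (mul_le_mul (hg₁b x') h3 (abs_nonneg _) hB₁)
  -- the remainder kernel applied to the leg
  have hΓv : ‖moveRem g₁ g₃ Γ' μ x x' x'' (φ'' x')‖ ≤ (H₁ * u₁ ^ α * B₃ + B₁ * (H₃ * u₂ ^ α)) *
      (K * Real.exp (-(δ * s⁻¹ * u₁)) * Real.exp (-(δ * s⁻¹ * u₂)) * ‖φ'' x'‖) := by
    simp only [moveRem, LinearMap.smul_apply, norm_smul, Real.norm_eq_abs]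
    exact mul_le_mul hdiff (hΓ μ x x' x'' _) (norm_nonneg _) (by positivity)
  -- the two gains
  have hw₁ := exp_mul_rpow_le hδ hs hu₁0 hα0 hα1
  have hw₂ := exp_mul_rpow_le hδ hs hu₂0 hα0 hα1
  have he₁ := exp_le_exp_half' hδ hs hu₁0
  have he₂ := exp_le_exp_half' hδ hs hu₂0
  have hE1 : u₁ ^ α * (Real.exp (-(δ * s⁻¹ * u₁)) * Real.exp (-(δ * s⁻¹ * u₂))) ≤
      (1 + 2 / δ) * s ^ α * (Real.exp (-(δ / 2 * s⁻¹ * u₁)) * Real.exp (-(δ / 2 * s⁻¹ * u₂))) := by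
    calc u₁ ^ α * (Real.exp (-(δ * s⁻¹ * u₁)) * Real.exp (-(δ * s⁻¹ * u₂)))
        = (Real.exp (-(δ * s⁻¹ * u₁)) * u₁ ^ α) * Real.exp (-(δ * s⁻¹ * u₂)) := by ring
      _ ≤ ((1 + 2 / δ) * s ^ α * Real.exp (-(δ / 2 * s⁻¹ * u₁))) * Real.exp (-(δ / 2 * s⁻¹ * u₂)) :=
          mul_le_mul hw₁ he₂ (Real.exp_pos _).le (by positivity)
      _ = _ := by ring
  have hE2 : u₂ ^ α * (Real.exp (-(δ * s⁻¹ * u₁)) * Real.exp (-(δ * s⁻¹ * u₂))) ≤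
      (1 + 2 / δ) * s ^ α * (Real.exp (-(δ / 2 * s⁻¹ * u₁)) * Real.exp (-(δ / 2 * s⁻¹ * u₂))) := by
    calc u₂ ^ α * (Real.exp (-(δ * s⁻¹ * u₁)) * Real.exp (-(δ * s⁻¹ * u₂)))
        = Real.exp (-(δ * s⁻¹ * u₁)) * (Real.exp (-(δ * s⁻¹ * u₂)) * u₂ ^ α) := by ring
      _ ≤ Real.exp (-(δ / 2 * s⁻¹ * u₁)) * ((1 + 2 / δ) * s ^ α * Real.exp (-(δ / 2 * s⁻¹ * u₂))) :=
          mul_le_mul he₁ hw₂ (by positivity) (Real.exp_pos _).le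
      _ = _ := by ring
  set E : ℝ := Real.exp (-(δ / 2 * s⁻¹ * u₁)) * Real.exp (-(δ / 2 * s⁻¹ * u₂)) with hE
  calc |g x' * A ⟨x', μ⟩| * ‖moveRem g₁ g₃ Γ' μ x x' x'' (φ'' x')‖
      ≤ B * ((H₁ * u₁ ^ α * B₃ + B₁ * (H₃ * u₂ ^ α)) *
          (K * Real.exp (-(δ * s⁻¹ * u₁)) * Real.exp (-(δ * s⁻¹ * u₂)) * ‖φ'' x'‖)) :=
        mul_le_mul (hgA μ x') hΓv (norm_nonneg _) hB
    _ = B * K * ‖φ'' x'‖ * (H₁ * B₃ * (u₁ ^ α * (Real.exp (-(δ * s⁻¹ * u₁)) * Real.exp (-(δ * s⁻¹ * u₂)))) +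
          B₁ * H₃ * (u₂ ^ α * (Real.exp (-(δ * s⁻¹ * u₁)) * Real.exp (-(δ * s⁻¹ * u₂))))) := by ring
    _ ≤ B * K * ‖φ'' x'‖ * (H₁ * B₃ * ((1 + 2 / δ) * s ^ α * E) + B₁ * H₃ * ((1 + 2 / δ) * s ^ α * E)) := by
        gcongr
    _ = K * B * (H₁ * B₃ + B₁ * H₃) * (1 + 2 / δ) * s ^ α * (‖φ'' x'‖ * E) := by ring

end Move

/-! ## 2. The local term is linear in its kernel -/

section Linear

variable {ι : Type*}

/-- kernel: the local term of (3.34)/(3.36) is additive in the kernel. [cite: Balaban1983Higgs3, (3.36) p.444] -/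
theorem local334_add (η : ℝ) (Γ₁ Γ₂ : Kernel3 P j W) (g : SiteField P j ℝ) (A : VecField P j ℝ) (φ' φ'' : SiteField P j W) :
    local334 η (Γ₁ + Γ₂) g A φ' φ'' = local334 η Γ₁ g A φ' φ'' + local334 η Γ₂ g A φ' φ'' := by
  rw [← tripleSum_local, ← tripleSum_local, ← tripleSum_local]
  simp only [tripleSum, Pi.add_apply, LinearMap.add_apply, inner_add_right, mul_add, Finset.sum_add_distrib]

/-- kernel: the local term vanishes for the zero kernel. [cite: Balaban1983Higgs3, (3.36) p.444] -/
theorem local334_zero (η : ℝ) (g : SiteField P j ℝ) (A : VecField P j ℝ) (φ' φ'' : SiteField P j W) :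
    local334 η (0 : Kernel3 P j W) g A φ' φ'' = 0 := by
  rw [← tripleSum_local]
  simp [tripleSum]

/-- kernel: the local term of a finite sum of kernels is the sum of the local terms. [cite: Balaban1983Higgs3, (3.36) p.444] -/
theorem local334_finset_sum (η : ℝ) (s : Finset ι) (Γ : ι → Kernel3 P j W) (g : SiteField P j ℝ) (A : VecField P j ℝ)
    (φ' φ'' : SiteField P j W) :
    local334 η (∑ i ∈ s, Γ i) g A φ' φ'' = ∑ i ∈ s, local334 η (Γ i) g A φ' φ'' := by
  classical
  induction s using Finset.induction_on with
  | empty => simp [local334_zero]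
  | insert i s hi ih => rw [Finset.sum_insert hi, Finset.sum_insert hi, local334_add, ih]

/-- kernel: (3.36) of a finite sum of unrestricted kernels is the sum of the (3.36)'s. [cite: Balaban1983Higgs3, (3.36) p.444] -/
theorem local336_finset_sum (η : ℝ) (s : Finset ι) (Γ' : ι → Kernel3 P j W) (locs : SiteField P j ℝ) (A : VecField P j ℝ)
    (φ' φ'' : SiteField P j W) :
    local336 η (∑ i ∈ s, Γ' i) locs A φ' φ'' = ∑ i ∈ s, local336 η (Γ' i) locs A φ' φ'' :=
  local334_finset_sum η s Γ' locs A φ' φ''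

end Linear

/-! ## 3. Summation of (3.36) over the j-indices of the internal lines -/

section Resum

/-- **p. 444 [PDF 34]**, verbatim: *"Next we sum the expressions (3.36) over admissible orderings and indices and we get the expressions of
the same type but with propagators G_{j₀}(0), G_{j₀}, where j₀ is the lowest index of the external legs."* — PROVED in the generality of
the printed *"expressions of the same type"*: for every MULTILINEAR dependence `Φ` of the unrestricted kernel `Γ′` on the kernels of the `m`
internal lines, and the decompositions (2.6) `G_l = Σ_{j<j₀} G_l^{(j)}` of the line propagators (`B3.Display26`), the sum of (3.36) over all
index assignments `(j_1, …, j_m) ∈ [0, j₀)^m` is (3.36) with the propagators `G_l` (= `G_{j₀}(0)`, `G_{j₀}`).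
[cite: Balaban1983Higgs3, (3.36) p.444] -/
theorem local336_resum (η : ℝ) {m j₀ : ℕ} (Φ : MultilinearMap ℝ (fun _ : Fin m => Kernel P j) (Kernel3 P j W))
    {G : Fin m → Kernel P j} {Gfam : Fin m → ℕ → Kernel P j} (h : ∀ l, B3.Display26 (G l) (Gfam l) j₀)
    (locs : SiteField P j ℝ) (A : VecField P j ℝ) (φ' φ'' : SiteField P j W) :
    ∑ r ∈ Fintype.piFinset (fun _ : Fin m => Finset.range j₀), local336 η (Φ fun l => Gfam l (r l)) locs A φ' φ'' =
      local336 η (Φ G) locs A φ' φ'' := by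
  have hG : G = fun l => ∑ i ∈ Finset.range j₀, Gfam l i := funext fun l => h l
  rw [hG, MultilinearMap.map_sum_finset, local336_finset_sum]

/-- The three-line shape of the unrestricted kernel for the triangle graphs (2.20): `Γ′_μ(x,x′,x″) = K₁(x,x′)K₂(x′,x″)K₃(x,x″)·T_μ` with the
three line kernels `K₁, K₂, K₃` and a fixed map `T_μ` of the internal indices (charge matrices). [cite: Balaban1983Higgs3, (3.36) p.444] -/
def triKernel (T : Fin P.d → W →ₗ[ℝ] W) (K₁ K₂ K₃ : Kernel P j) : Kernel3 P j W :=
  fun μ x x' x'' => (K₁ x x' * K₂ x' x'' * K₃ x x'') • T μ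

/-- kernel: the three-line shape is trilinear in the line kernels — with the decompositions (2.6) of the three lines it splits into the
triple sum over their indices. [cite: Balaban1983Higgs3, (3.36) p.444] -/
theorem triKernel_sum {ι₁ ι₂ ι₃ : Type*} (s₁ : Finset ι₁) (s₂ : Finset ι₂) (s₃ : Finset ι₃) (T : Fin P.d → W →ₗ[ℝ] W)
    (K₁ : ι₁ → Kernel P j) (K₂ : ι₂ → Kernel P j) (K₃ : ι₃ → Kernel P j) :
    triKernel T (∑ i ∈ s₁, K₁ i) (∑ i ∈ s₂, K₂ i) (∑ i ∈ s₃, K₃ i) =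
      ∑ i₁ ∈ s₁, ∑ i₂ ∈ s₂, ∑ i₃ ∈ s₃, triKernel T (K₁ i₁) (K₂ i₂) (K₃ i₃) := by
  funext μ x x' x''
  simp only [triKernel, Finset.sum_apply, Finset.sum_mul, Finset.mul_sum, Finset.sum_smul]
  calc ∑ k ∈ s₃, ∑ i₂ ∈ s₂, ∑ i ∈ s₁, (K₁ i x x' * K₂ i₂ x' x'' * K₃ k x x'') • T μ
      = ∑ i₂ ∈ s₂, ∑ k ∈ s₃, ∑ i ∈ s₁, (K₁ i x x' * K₂ i₂ x' x'' * K₃ k x x'') • T μ := Finset.sum_comm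
    _ = ∑ i₂ ∈ s₂, ∑ i ∈ s₁, ∑ k ∈ s₃, (K₁ i x x' * K₂ i₂ x' x'' * K₃ k x x'') • T μ :=
        Finset.sum_congr rfl fun _ _ => Finset.sum_comm
    _ = ∑ i ∈ s₁, ∑ i₂ ∈ s₂, ∑ k ∈ s₃, (K₁ i x x' * K₂ i₂ x' x'' * K₃ k x x'') • T μ := Finset.sum_comm

/-- **p. 444 [PDF 34]**, the resummation of (3.36) for the three-line (triangle) shape: summing over the indices `j, j′, j″ < j₀` of the
three internal lines gives (3.36) with the resummed propagators (`B3.Display26`: `G_l = Σ_{i<j₀} G_l^{(i)}`, `l = 1, 2, 3`).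
[cite: Balaban1983Higgs3, (3.36) p.444] -/
theorem local336_triKernel_resum (η : ℝ) {j₀ : ℕ} (T : Fin P.d → W →ₗ[ℝ] W) {G₁ G₂ G₃ : Kernel P j} {F₁ F₂ F₃ : ℕ → Kernel P j}
    (h₁ : B3.Display26 G₁ F₁ j₀) (h₂ : B3.Display26 G₂ F₂ j₀) (h₃ : B3.Display26 G₃ F₃ j₀)
    (locs : SiteField P j ℝ) (A : VecField P j ℝ) (φ' φ'' : SiteField P j W) :
    ∑ i₁ ∈ Finset.range j₀, ∑ i₂ ∈ Finset.range j₀, ∑ i₃ ∈ Finset.range j₀,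
        local336 η (triKernel T (F₁ i₁) (F₂ i₂) (F₃ i₃)) locs A φ' φ'' =
      local336 η (triKernel T G₁ G₂ G₃) locs A φ' φ'' := by
  rw [h₁, h₂, h₃, triKernel_sum, local336_finset_sum]
  refine Finset.sum_congr rfl fun i₁ _ => ?_
  rw [local336_finset_sum]
  refine Finset.sum_congr rfl fun i₂ _ => ?_
  rw [local336_finset_sum]

end Resum

end

end Literature.MathematicalPhysics.QuantumFieldTheory.Balaban1983to89.B3Resummation336
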